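import Summits.KontsevichZagierPeriods.Zeta5Search.WellPoisedFaceTailRate
import Summits.KontsevichZagierPeriods.Zeta5Search.WellPoisedFaceLinearFormsPF
import HarnessLib

/-!
# Odd-zeta search — the face forms with `B` tail bricks are linear forms in `1, ζ(5), ζ(7), …, ζ(B+1)`,
# part 1: partial fractions, reflection, real-analytic bridge (cell `pub-zeta5`, fam-odd gen 9)

HONEST FRAMING: systematic search; no irrationality claim unless certified.

fam-vwp gen 7 proved in the kernel (`WellPoisedFaceLinearFormsPF` / `WellPoisedFaceLinearForms`, `η : Fin 4 → ℕ`,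
the `q = 7` box) that Zudilin's face form `F(h_n) = ½ Σ_{t ≥ 0} R″(t)` is `A·ζ(5) − B` over `ℚ` with controlled
denominators.  fam-odd gen 8 (`WellPoisedFaceTailRate`, `WellPoisedFaceTailSandwich`, `WellPoisedFaceOddGrowthFree`)
redid the ANALYTIC half for any number `B` of tail bricks (`tailR`, `tailF`; the boxes `q = B + 3 ≤ 11`, windows
`{ζ5}`, `{ζ5, ζ7}`, `{ζ5, ζ7, ζ9}`), so that the integer-normalised face forms grow with no hypothesis left.
THIS FILE and part 2 (`WellPoisedFaceTailLinearForms`) prove the ARITHMETIC MEANING for any `B`: on every integral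
face direction (`2η_j < η₀`) and every `n`,

  `F_n = Σ_{s odd, 5 ≤ s ≤ B+1} A_s ζ(s) − A₀`,  `A_s, A₀ ∈ ℚ`,  `D_{η₀n}^{B+2−s} A_s ∈ ℤ`,  `D_{η₀n}^{B+2} A₀ ∈ ℤ`

(`B` even, `B ≥ 3`; part 2, `tailF_linearForm_odd`) — NO `ζ(3)` (the residues of `R` sum to zero because
`t·R(t) → 0`, which needs `B ≥ 3`), NO EVEN zeta value (the well-poised reflection below), exactly the mechanism of
[Zudilin2004, Lemma 19 with (8.10)] = [BallRivoal2001] / [Rivoal2000, Lemme 1].  For `B = 4` this is fam-vwp's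
theorem again; for `B = 6, 8` it is the meaning of the `q = 9, 11` face theorems of fam-odd 5–11: the growing forms
`Λ_n` of `IntFaceDir.faceLambda_faceForm_tendsto_atTop` lie in `ℚ + ℚζ(5) + ℚζ(7) (+ ℚζ(9))`.  Growing forms prove
nothing about `ζ(5)`, `ζ(7)`, `ζ(9)`; what stays PRINTED is Lemma 19's sharp denominator and the `Φ⁻¹` saving.

Contents of part 1 (all for arbitrary `B`, proofs = fam-vwp's with `Fin 4 ↦ Fin B`):
* §T1 `tailRQ` (the rational skeleton of file A's `tailR`), `exists_tailData`: Ball–Rivoal partial-fraction data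
  `c_{o,p}` (`o < B`, `p ≤ η₀ n`) with `D_{η₀n}^{B−1−o} c_{o,p} ∈ ℤ` and `R = Σ c_{o,p}/(t+p+1)^{o+1} + C`;
* §T2 the well-poised reflection with its `B`-dependent sign `R(−t − h₀) = (−1)^{B(η₀n+1)+1} R(t)` (`tailRQ_reflect`);
* §T3 the real-analytic bridge `tailPfR`, `tailR_eq_pfR` (density of `ℚ`; continuity by file A's `hasDerivAt_tailR`).
Standard axioms only.
-/

noncomputable section

open Finset Filter Topology

namespace Summit.KontsevichZagierPeriods.Zeta5Search.WellPoisedFaceRate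

open Literature.NumberTheory.Transcendental (zetaValue)
open Literature.NumberTheory.Transcendental.BallRivoal (pfEval brickEval IsInt poch exists_pf_prod)
open Summit.KontsevichZagierPeriods.Zeta5Search.PFSteps (linStep subRes trunc pfEval_linStep linStep_of_le
  isInt_linStep pfEval_trunc isInt_trunc trunc_of_le subBlock_eq_brickEval)
open Summit.KontsevichZagierPeriods.Zeta5Search.DualSeriesDenominators (natCast_dvd_lcmUpto)

variable {B : ℕ}

/-! ## T1. The rational skeleton of `R` with `B` tail bricks and its partial fractions -/

/-- `η : Fin B → ℕ` extended by `0` to all of `ℕ`, to index the bricks by `range B`. -/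
def etaB (η : Fin B → ℕ) (s : ℕ) : ℕ := if h : s < B then η ⟨s, h⟩ else 0

/-- `etaB` agrees with `η` on `Fin B`. -/
theorem etaB_fin (η : Fin B → ℕ) (j : Fin B) : etaB η j = η j := by
  simp [etaB, j.isLt]

/-- Residues of the `B` face bricks in the frame `(t+1)_{η₀ n + 1}`: brick `s` is the sub-block brick at offset
`η_s n` (first pole `t + h_s`, `h_s = η_s n + 1`) of length `L_s = h₀ − 2h_s + 1`. -/
def tailBrickRes (η₀ : ℕ) (η : Fin B → ℕ) (n : ℕ) : ℕ → ℕ → ℤ :=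
  fun s => subRes (etaB η s * n) ((η₀ * n + 2) - 2 * (etaB η s * n + 1) + 1)

/-- Zudilin's `R(t)` on the face with `B` tail bricks and RATIONAL argument: the same expression as file A's
real `tailR`. -/
def tailRQ (η₀ : ℕ) (η : Fin B → ℕ) (n : ℕ) (t : ℚ) : ℚ :=
  (((η₀ * n + 2 : ℕ) : ℚ) + 2 * t) * ∏ j : Fin B,
    ((((η₀ * n + 2) - 2 * (η j * n + 1)).factorial : ℕ) : ℚ)
      / ∏ i ∈ Finset.range ((η₀ * n + 2) - 2 * (η j * n + 1) + 1), (t + ((η j * n + 1 : ℕ) : ℚ) + (i : ℚ))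

variable (η₀ : ℕ) (η : Fin B → ℕ) (n : ℕ)

/-- `tailR` at a rational point is the cast of `tailRQ`. -/
theorem cast_tailRQ (t : ℚ) : ((tailRQ η₀ η n t : ℚ) : ℝ) = tailR η₀ η n (t : ℝ) := by
  unfold tailRQ tailR
  push_cast
  rfl

/-- One face brick is the sub-block brick of the frame:
`(h₀−2h_j)!/∏_{i ≤ h₀−2h_j}(t + h_j + i) = Σ_p A_p/(t+p+1)`. -/
theorem tail_brick_eq_brickEval (hη : ∀ j, 2 * η j < η₀) (j : Fin B) (t : ℚ)
    (ht : ∀ p, p ≤ η₀ * n → t + p + 1 ≠ 0) :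
    ((((η₀ * n + 2) - 2 * (η j * n + 1)).factorial : ℕ) : ℚ)
        / ∏ i ∈ Finset.range ((η₀ * n + 2) - 2 * (η j * n + 1) + 1), (t + ((η j * n + 1 : ℕ) : ℚ) + (i : ℚ))
      = brickEval (η₀ * n) (tailBrickRes η₀ η n j) t := by
  have hj := hη j
  have h2 : 2 * (η j * n) ≤ η₀ * n := by rw [← mul_assoc]; exact Nat.mul_le_mul_right n hj.le
  have hL1 : 1 ≤ (η₀ * n + 2) - 2 * (η j * n + 1) + 1 := by omega
  have hL2 : η j * n + ((η₀ * n + 2) - 2 * (η j * n + 1) + 1) ≤ η₀ * n + 1 := by omega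
  have key := subBlock_eq_brickEval (η₀ * n) (η j * n) ((η₀ * n + 2) - 2 * (η j * n + 1) + 1) hL1 hL2 t ht
  rw [show (η₀ * n + 2) - 2 * (η j * n + 1) + 1 - 1 = (η₀ * n + 2) - 2 * (η j * n + 1) by omega] at key
  simp only [tailBrickRes, etaB_fin]
  rw [← key, poch]
  congr 1
  refine prod_congr rfl fun i _ => ?_
  push_cast
  ring

/-- The product of the `B` face bricks is the Ball–Rivoal product of bricks over `range B`. -/
theorem tail_prod_bricks_eq (hη : ∀ j, 2 * η j < η₀) (t : ℚ) (ht : ∀ p, p ≤ η₀ * n → t + p + 1 ≠ 0) :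
    ∏ j : Fin B, ((((η₀ * n + 2) - 2 * (η j * n + 1)).factorial : ℕ) : ℚ)
        / ∏ i ∈ Finset.range ((η₀ * n + 2) - 2 * (η j * n + 1) + 1), (t + ((η j * n + 1 : ℕ) : ℚ) + (i : ℚ))
      = ∏ s ∈ range B, brickEval (η₀ * n) (tailBrickRes η₀ η n s) t := by
  rw [← Fin.prod_univ_eq_prod_range (fun s => brickEval (η₀ * n) (tailBrickRes η₀ η n s) t) B]
  exact prod_congr rfl fun j _ => tail_brick_eq_brickEval η₀ η n hη j t ht

/-- **Partial fractions of `R` with `B ≥ 1` tail bricks** (Ball–Rivoal data, one integer linear step for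
`h₀ + 2t`): there are data `c_{o,p}` (`o < B`, `p ≤ η₀ n`) with `D_{η₀ n}^{B−1−o} c_{o,p} ∈ ℤ` and a constant `C`
with `R(t) = Σ_{p,o} c_{o,p}/(t+p+1)^{o+1} + C` away from the poles (`C = 0` for `B ≥ 3`: part 2). -/
theorem exists_tailData (hB : 1 ≤ B) (hη : ∀ j, 2 * η j < η₀) :
    ∃ c : ℕ → ℕ → ℚ, IsInt B (Nat.lcmUpto (η₀ * n)) c ∧
      ∃ C : ℚ, ∀ t : ℚ, (∀ p, p ≤ η₀ * n → t + p + 1 ≠ 0) →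
        tailRQ η₀ η n t = pfEval (η₀ * n) B c t + C := by
  obtain ⟨c, hc, hint, -⟩ := exists_pf_prod (η₀ * n) (Nat.lcmUpto (η₀ * n))
    (fun k hk1 hk2 => natCast_dvd_lcmUpto hk1 hk2) (tailBrickRes η₀ η n) B hB
  have htr : ∀ o p, B ≤ o → trunc B c o p = 0 := fun o p ho => trunc_of_le ho p
  refine ⟨linStep 2 ((η₀ * n + 2 : ℕ) : ℤ) (trunc B c), isInt_linStep _ _ htr (isInt_trunc hint),
    2 * ∑ p ∈ range (η₀ * n + 1), trunc B c 0 p, fun t ht => ?_⟩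
  rw [pfEval_linStep (η₀ * n) B _ _ _ htr t ht, pfEval_trunc, hc t ht, ← tail_prod_bricks_eq η₀ η n hη t ht]
  unfold tailRQ
  push_cast
  ring

/-! ## T2. The well-poised reflection `R(−t − h₀) = (−1)^{B(η₀n+1)+1} R(t)` -/

/-- Every face brick has the same reflection sign `(−1)^{L_j} = (−1)^{η₀ n + 1}` (`L_j = (η₀ − 2η_j)n + 1`). -/
theorem tail_brick_sign (hη : ∀ j, 2 * η j < η₀) (j : Fin B) :
    ((-1 : ℚ)) ^ ((η₀ * n + 2) - 2 * (η j * n + 1) + 1) = (-1) ^ (η₀ * n + 1) := by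
  have h2 : 2 * (η j * n) ≤ η₀ * n := by rw [← mul_assoc]; exact Nat.mul_le_mul_right n (hη j).le
  have hsum : ((η₀ * n + 2) - 2 * (η j * n + 1) + 1) + 2 * (η j * n) = η₀ * n + 1 := by omega
  rw [← hsum, pow_add _ _ (2 * (η j * n)), pow_mul, neg_one_sq, one_pow, mul_one]

/-- **Well-poised reflection with `B` bricks** [Zudilin2004, (8.10), face]: `R(−t − h₀) = (−1)^{B(η₀n+1)+1} R(t)`
(`h₀ = η₀ n + 2`): each of the `B` brick denominators reflects with the sign `(−1)^{η₀n+1}` and the very-well-poised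
factor `h₀ + 2t` with `−1`.  For even `B` this is `R(−t − h₀) = −R(t)` as in the `q = 7` file.  An identity of
rational functions (poles go to poles, where both sides are `0` by `x/0 = 0`). -/
theorem tailRQ_reflect (hη : ∀ j, 2 * η j < η₀) (t : ℚ) :
    tailRQ η₀ η n (-t - ((η₀ * n : ℕ) : ℚ) - 2) = (-1) ^ (B * (η₀ * n + 1) + 1) * tailRQ η₀ η n t := by
  have hD : ∀ j : Fin B,
      ∏ i ∈ Finset.range ((η₀ * n + 2) - 2 * (η j * n + 1) + 1),
          (-t - ((η₀ * n : ℕ) : ℚ) - 2 + ((η j * n + 1 : ℕ) : ℚ) + (i : ℚ))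
        = (-1) ^ (η₀ * n + 1) * ∏ i ∈ Finset.range ((η₀ * n + 2) - 2 * (η j * n + 1) + 1),
            (t + ((η j * n + 1 : ℕ) : ℚ) + (i : ℚ)) := by
    intro j
    have h2 : 2 * (η j * n) ≤ η₀ * n := by rw [← mul_assoc]; exact Nat.mul_le_mul_right n (hη j).le
    rw [← tail_brick_sign η₀ η n hη j]
    refine prod_reflect t _ _ _ ?_
    have hle : 2 * (η j * n + 1) ≤ η₀ * n + 2 := by omega
    push_cast
    rw [Nat.cast_sub hle]
    push_cast
    ring
  have hσ : (((-1 : ℚ) ^ (η₀ * n + 1))⁻¹) ^ B = (-1) ^ (B * (η₀ * n + 1)) := by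
    rw [inv_pow, ← pow_mul, ← inv_pow, inv_neg_one, mul_comm (η₀ * n + 1) B]
  have hdiv : ∀ x y : ℚ, x / ((-1 : ℚ) ^ (η₀ * n + 1) * y) = x / y * ((-1 : ℚ) ^ (η₀ * n + 1))⁻¹ := by
    intro x y
    rw [div_mul_eq_div_div_swap, div_eq_mul_inv]
  unfold tailRQ
  simp_rw [hD, hdiv]
  rw [prod_mul_distrib, prod_const, Finset.card_univ, Fintype.card_fin, hσ, pow_succ]
  push_cast
  ring

/-! ## T3. Real-analytic bridge: `R` and the partial fractions as real functions -/

/-- The real partial-fraction sum of data `c` with `K` orders on the frame `t+1, …, t+N+1`. -/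
def tailPfR (N K : ℕ) (c : ℕ → ℕ → ℚ) (y : ℝ) : ℝ :=
  ∑ p ∈ range (N + 1), ∑ o ∈ range K, (c o p : ℝ) * ((y + ((p + 1 : ℕ) : ℝ)) ^ (o + 1))⁻¹

/-- At rational points `tailPfR` is the cast of Ball–Rivoal's `pfEval`. -/
theorem cast_tailPfEval (N K : ℕ) (c : ℕ → ℕ → ℚ) (q : ℚ) :
    ((pfEval N K c q : ℚ) : ℝ) = tailPfR N K c q := by
  unfold pfEval tailPfR
  push_cast
  refine sum_congr rfl fun p _ => sum_congr rfl fun o _ => ?_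
  rw [div_eq_mul_inv, show (q : ℝ) + (p : ℝ) + 1 = (q : ℝ) + ((p : ℝ) + 1) by ring]

/-- `tailPfR` is smooth at every `y > −1`. -/
theorem contDiffAt_tailPfR (N K : ℕ) (c : ℕ → ℕ → ℚ) {y : ℝ} (hy : -1 < y) {M : WithTop ℕ∞} :
    ContDiffAt ℝ M (tailPfR N K c) y := by
  unfold tailPfR
  refine ContDiffAt.sum fun p _ => ContDiffAt.sum fun o _ => contDiffAt_const.mul (contDiffAt_inv_pow' _ _ ?_)
  push_cast
  linarith

/-- Termwise second derivative of `tailPfR` at `y > −1`. -/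
theorem iteratedDeriv_two_tailPfR (N K : ℕ) (c : ℕ → ℕ → ℚ) {y : ℝ} (hy : -1 < y) :
    iteratedDeriv 2 (tailPfR N K c) y = ∑ p ∈ range (N + 1), ∑ o ∈ range K,
      (c o p : ℝ) * ((((o + 1 : ℕ) : ℝ) * ((o + 1 : ℕ) + 1)) * ((y + ((p + 1 : ℕ) : ℝ)) ^ (o + 1 + 2))⁻¹) := by
  have hpos : ∀ p : ℕ, 0 < y + ((p + 1 : ℕ) : ℝ) := fun p => by push_cast; linarith
  unfold tailPfR
  rw [iteratedDeriv_fun_sum fun p _ =>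
    ContDiffAt.sum fun o _ => contDiffAt_const.mul (contDiffAt_inv_pow' _ _ (hpos p))]
  refine sum_congr rfl fun p _ => ?_
  rw [iteratedDeriv_fun_sum fun o _ => contDiffAt_const.mul (contDiffAt_inv_pow' _ _ (hpos p))]
  refine sum_congr rfl fun o _ => ?_
  rw [iteratedDeriv_const_mul _ (contDiffAt_inv_pow' _ _ (hpos p)), iteratedDeriv_two_inv_pow' _ _ (hpos p)]

/-- **`R = partial fractions + C` as REAL functions on `y > −1/2`** (from the rational identity by density of `ℚ`:
`tailR` is continuous there by file A's `hasDerivAt_tailR`, and so is `tailPfR`). -/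
theorem tailR_eq_pfR {c : ℕ → ℕ → ℚ} {C : ℚ}
    (hc : ∀ t : ℚ, (∀ p, p ≤ η₀ * n → t + p + 1 ≠ 0) → tailRQ η₀ η n t = pfEval (η₀ * n) B c t + C)
    {y : ℝ} (hy : -1/2 < y) : tailR η₀ η n y = tailPfR (η₀ * n) B c y + C := by
  set f : ℝ → ℝ := fun z => tailR η₀ η n z - (tailPfR (η₀ * n) B c z + C) with hf
  have hfc : ContinuousAt f y :=
    (hasDerivAt_tailR η₀ η n hy).continuousAt.sub
      (((contDiffAt_tailPfR (η₀ * n) B c (by linarith) (M := 0)).continuousAt).add continuousAt_const)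
  haveI : (𝓝[Set.range ((↑) : ℚ → ℝ)] y).NeBot := Rat.denseRange_cast.nhdsWithin_neBot y
  have h1 : Tendsto f (𝓝[Set.range ((↑) : ℚ → ℝ)] y) (𝓝 (f y)) :=
    hfc.tendsto.mono_left nhdsWithin_le_nhds
  have h2 : f =ᶠ[𝓝[Set.range ((↑) : ℚ → ℝ)] y] fun _ => 0 := by
    have hpos : ∀ᶠ z in 𝓝[Set.range ((↑) : ℚ → ℝ)] y, -1/2 < z :=
      mem_nhdsWithin_of_mem_nhds (Ioi_mem_nhds hy)
    filter_upwards [hpos, self_mem_nhdsWithin] with z hz hmem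
    obtain ⟨q, rfl⟩ := hmem
    have hz' : (-1/2 : ℝ) < (q : ℝ) := hz
    have hq : ∀ p, p ≤ η₀ * n → (q : ℚ) + p + 1 ≠ 0 := by
      intro p _ h0
      have h0' : ((q : ℚ) : ℝ) + (p : ℝ) + 1 = 0 := by exact_mod_cast h0
      have hp0 : (0 : ℝ) ≤ (p : ℝ) := by positivity
      linarith
    have e := hc q hq
    have e' : tailR η₀ η n (q : ℝ) = tailPfR (η₀ * n) B c q + (C : ℝ) := by
      rw [← cast_tailRQ, e, Rat.cast_add, cast_tailPfEval]
    simp only [hf, e', sub_self]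
  have := tendsto_nhds_unique (h1.congr' h2) tendsto_const_nhds
  simp only [hf] at this
  linarith

end Summit.KontsevichZagierPeriods.Zeta5Search.WellPoisedFaceRate
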